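import Literature.AlgebraicGeometry.Modules.SubbundleEquationsBaseChange
import Literature.AlgebraicGeometry.Modules.ProjectiveFamilyTwistPushforward
import Literature.AlgebraicGeometry.Modules.SerreTheoremA
import Literature.AlgebraicGeometry.Modules.SheafHomPushforward
import Literature.AlgebraicGeometry.Modules.CechBaseChangeHom
import HarnessLib

/-!
# The vanishing locus of equations with values in `𝒪(d)`: its ideal on the chart `Z_j` is generated by the `j`-coordinates of the equations

Topic `Literature/AlgebraicGeometry/Modules`, namespace `Literature.AlgebraicGeometry.Modules`.  THEOREMS ONLY (no definition, no
instance, no notation, no named fact, no `sorry`).  Cell `hodgecm-mathlib` (D-0151), F-DAG leaf F-5 (5d) (director s232; B-plan1 (g17)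
09:09:40Z), FILE 3b of the (II′) MONO wrapper (author B-p20 (g12), census `CENSUS-5dII-Mono`): the CHART BRIDGE between the sheaf letter
`V(v♭)` of ★ `Modules/SubbundleEquationsBaseChange` (the vanishing locus of the transposed equations `v♭ : π^* K ⟶ 𝒪(d)`) and the chart
letter of ★ `Morphisms/ProjectiveSubschemeCutOutByDegreeEquations` (ideals of `Γ(Z_j)` generated by dehomogenised forms).  Count-neutral
Mathlib-side capital: HC_CM is proved only modulo the 7 printed citations until rung 0 closes — nothing here is about HC.

SETTING ([Hartshorne1977] II Prop. 5.12: `𝒪(d)` is trivial on the standard charts; the tree's twist model ★ `Modules/SerreTwistMod`,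
`SerreTwistModCharts`): `ιP : P ⟶ 𝐏^r_A` affine (so the charts `Z_j = ιP⁻¹ D₊(x_j)` are affine, ★ `SerreTwist.isAffineOpen_Zop`),
`L := SerreTwist.twistMod ιP (unitModule P) d` the `d`-th twist with its chart trivialisations
`chartEquiv : Γ(L, V) ≃ₗ[Γ(V)] Γ(𝒪, V)` (`V ⊆ Z_j`; a twisted chart family ↦ its `j`-th component), `π : P ⟶ T` with `T` AFFINE,
`K` an affine-localizing `𝒪_T`-module and `v : K ⟶ π_* L` (the equations; `v♭ : π^* K ⟶ L` its transpose).  Then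
([Fulton1998] B.3.4: the zero scheme of a section of a bundle is cut out, on a trivialising open, by its coordinates):

* §1 `appLE_eq_chartEquiv_mul` — every functional `μ : L|_W ⟶ 𝒪|_W` (`W ⊆ Z_j`) is a multiple of the coordinate:
  `μ(n) = chartEquiv(n) · μ(e_W)`; `transpose_app_unitSectionLE` — `v♭(η_π(k)|_W) = v(k)|_W`;
* §2 **`vanishingIdeal_transpose_ideal_Zop_eq_span`** — the ideal of `V(v♭)` on `Z_j` is generated by the `j`-coordinates
  `chartEquiv (v(k)|_{Z_j})` of the global equations `v(k)`, `k ∈ Γ(K, T)` (★ `vanishingIdeal_ideal`: the ideal is the ideal of values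
  `μ(v♭(s))`; the sections `s` of `π^* K` over the affine `Z_j` are generated by the `η_π(k)|` — ★ `isBaseChange_unitSectionLE`).

## References
* [Fulton1998] W. Fulton, *Intersection Theory*, 2nd ed. (1998), App. B.3.4 (PDF p. 410).
* [Hartshorne1977] R. Hartshorne, *Algebraic Geometry* (1977), II Prop. 5.12 (p. 117: `𝒪_X(n)` and its chart description), II §5 p. 110.
* [Mumford1966CurvesSurface] D. Mumford, *Lectures on Curves on an Algebraic Surface* (1966), Lecture 15 (IV.)–(V.) (pp. 107–108).
-/

noncomputable section

-- `TopCat.Presheaf`/`Scheme.Modules` are not reducible (as in Mathlib's `AlgebraicGeometry/Modules`).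
set_option backward.isDefEq.respectTransparency false

universe u

open CategoryTheory CategoryTheory.Limits AlgebraicGeometry TopologicalSpace Opposite
open Literature.AlgebraicGeometry.Morphisms Literature.AlgebraicGeometry.Morphisms.ProjCech
open Literature.Algebra.Homology Literature.Algebra.Homology.LaurentCech

namespace Literature.AlgebraicGeometry.Modules

open SerreTwist Literature.AlgebraicGeometry.Motives

variable {A : Type u} [CommRing A] {r : ℕ} {P T : Scheme.{u}} (ιP : P ⟶ PP A r) (π : P ⟶ T) {K : T.Modules} (d : ℕ)
  (v : K ⟶ (Scheme.Modules.pushforward π).obj (twistMod ιP (unitModule P) d))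

/-! ## §1 Functionals on `𝒪(d)|_{Z_j}` and the equations on pulled-back sections -/

/-- **Every functional `μ : 𝒪(d)|_W ⟶ 𝒪|_W` on a chart open `W ⊆ Z_j` is a multiple of the coordinate**: `μ(n) = n_j · μ(e_W)` where
`n_j = chartEquiv n` is the `j`-th chart component and `e_W = chartEquiv⁻¹ 1` the trivialising section (`chartEquiv` is `Γ(W)`-linear,
★ `Modules/SerreTwistModCharts`). [cite: Hartshorne1977, II Prop. 5.12 (p. 117)] -/
theorem appLE_eq_chartEquiv_mul {j : Fin (r + 1)} {W : P.Opens} (hW : W ≤ Zop ιP {j})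
    (μ : (twistMod ιP (unitModule P) d).over W ⟶ (unitModule P).over W) (n : Γ(twistMod ιP (unitModule P) d, W)) :
    (show Γ(P, W) from appLE μ (𝟙 W) n) =
      (show Γ(P, W) from chartEquiv ιP (unitModule P) d hW n) *
        (show Γ(P, W) from appLE μ (𝟙 W) ((chartEquiv ιP (unitModule P) d hW).symm (1 : Γ(P, W)))) := by
  have hn : n = (show Γ(P, W) from chartEquiv ιP (unitModule P) d hW n) •
      (chartEquiv ιP (unitModule P) d hW).symm (1 : Γ(P, W)) := by
    apply (chartEquiv ιP (unitModule P) d hW).injective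
    rw [map_smul, LinearEquiv.apply_symm_apply]
    change (show Γ(P, W) from chartEquiv ιP (unitModule P) d hW n) =
      (show Γ(P, W) from chartEquiv ιP (unitModule P) d hW n) * (1 : Γ(P, W))
    rw [mul_one]
  conv_lhs => rw [hn]
  rw [appLE_smul_right]
  rfl

/-- **`v♭(η_π(k)|_W) = v(k)|_W`**: the transposed equations on the restricted pulled-back section of `k ∈ Γ(K, ⊤)` (★
`transpose_app_unitSection`, restricted). [cite: Hartshorne1977, II §5 p. 110] -/
theorem transpose_app_unitSectionLE {W : P.Opens} (i : W ≤ π ⁻¹ᵁ ⊤) (k : Γ(K, ⊤)) :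
    (((Scheme.Modules.pullbackPushforwardAdjunction π).homEquiv K _).symm v).app W (unitSectionLE π K i k) =
      (twistMod ιP (unitModule P) d).presheaf.map (homOfLE i).op
        (show Γ(twistMod ιP (unitModule P) d, π ⁻¹ᵁ ⊤) from v.app ⊤ k) := by
  rw [unitSectionLE, app_presheaf_map, transpose_app_unitSection]

/-! ## §2 The ideal of `V(v♭)` on the chart `Z_j` -/

/-- **THE IDEAL OF THE VANISHING LOCUS OF THE EQUATIONS ON A STANDARD CHART**: for `ιP : P ⟶ 𝐏^r_A` affine, `L = 𝒪_P(d)` the twist,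
`π : P ⟶ T` with `T` affine, `K` affine-localizing and equations `v : K ⟶ π_* L`, the ideal of `V(v♭)` on `Z_j = ιP⁻¹ D₊(x_j)` is
generated by the `j`-th chart coordinates of the restricted global equations `v(k)|_{Z_j}`, `k ∈ Γ(K, T)`: the ideal is the ideal of
values `μ(v♭(s))` (★ `vanishingIdeal_ideal`), the sections `s ∈ Γ(π^* K, Z_j)` are `Γ(Z_j)`-combinations of the `η_π(k)|` (★
`isBaseChange_unitSectionLE`), `v♭(η_π(k)|) = v(k)|` and every functional is a multiple of the coordinate (§1).
[cite: Fulton1998, B.3.4 (PDF p. 410)] [cite: Hartshorne1977, II Prop. 5.12 (p. 117)] [cite: Mumford1966CurvesSurface, Lecture 15 (IV.)–(V.) (pp. 107–108)] -/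
theorem vanishingIdeal_transpose_ideal_Zop_eq_span [IsAffineHom ιP] [IsAffine T] (hK : IsAffineLocalizing K) (j : Fin (r + 1)) :
    (vanishingIdeal (((Scheme.Modules.pullbackPushforwardAdjunction π).homEquiv K _).symm v)).ideal
        ⟨Zop ιP {j}, isAffineOpen_Zop ιP (Finset.singleton_nonempty j)⟩ =
      Ideal.span (Set.range fun k : Γ(K, ⊤) =>
        show Γ(P, Zop ιP {j}) from chartEquiv ιP (unitModule P) d (le_refl (Zop ιP {j}))
          ((twistMod ιP (unitModule P) d).presheaf.map (homOfLE (le_top : Zop ιP {j} ≤ π ⁻¹ᵁ ⊤)).op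
            (show Γ(twistMod ιP (unitModule P) d, π ⁻¹ᵁ ⊤) from v.app ⊤ k))) := by
  have hWa : IsAffineOpen (Zop ιP {j}) := isAffineOpen_Zop ιP (Finset.singleton_nonempty j)
  have hLf : IsFiniteLocallyFree (twistMod ιP (unitModule P) d) := isFiniteLocallyFree_twistMod_unitModule ιP d
  have i : Zop ιP {j} ≤ π ⁻¹ᵁ ⊤ := le_top
  rw [vanishingIdeal_ideal _ (hK.pullback π) (isAffineLocalizing_dual_of_isFiniteLocallyFree hLf) ⟨Zop ιP {j}, hWa⟩]
  -- the restricted equations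
  have happ : ∀ k : Γ(K, ⊤),
      (((Scheme.Modules.pullbackPushforwardAdjunction π).homEquiv K _).symm v).app (Zop ιP {j}) (unitSectionLE π K i k) =
        (twistMod ιP (unitModule P) d).presheaf.map (homOfLE i).op
          (show Γ(twistMod ιP (unitModule P) d, π ⁻¹ᵁ ⊤) from v.app ⊤ k) :=
    fun k => transpose_app_unitSectionLE ιP π d v i k
  apply le_antisymm
  · -- `≤`: every value `μ(v♭(s))` is a combination of the coordinates
    rw [vanishingValueIdeal, Ideal.span_le]
    rintro _ ⟨⟨s, μ⟩, rfl⟩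
    change (show Γ(P, Zop ιP {j}) from appLE μ (𝟙 _)
      ((((Scheme.Modules.pullbackPushforwardAdjunction π).homEquiv K _).symm v).app (Zop ιP {j}) s)) ∈ _
    letI : Algebra Γ(T, ⊤) Γ(P, Zop ιP {j}) := (π.appLE ⊤ (Zop ιP {j}) i).hom.toAlgebra
    letI : Module Γ(T, ⊤) Γ((Scheme.Modules.pullback π).obj K, Zop ιP {j}) :=
      Module.compHom _ (π.appLE ⊤ (Zop ιP {j}) i).hom
    haveI : IsScalarTower Γ(T, ⊤) Γ(P, Zop ιP {j}) Γ((Scheme.Modules.pullback π).obj K, Zop ιP {j}) :=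
      ⟨fun a b x => mul_smul ((π.appLE ⊤ (Zop ιP {j}) i).hom a) b x⟩
    have hbc := isBaseChange_unitSectionLE π K i (isAffineOpen_top T) hWa hK
    refine hbc.inductionOn s
      (fun s => (show Γ(P, Zop ιP {j}) from appLE μ (𝟙 _)
        ((((Scheme.Modules.pullbackPushforwardAdjunction π).homEquiv K _).symm v).app (Zop ιP {j}) s)) ∈ _) ?_ ?_ ?_ ?_
    · rw [map_zero, appLE_zero_right]
      exact Ideal.zero_mem _
    · intro k
      rw [unitSectionLEₗ_apply, happ k, appLE_eq_chartEquiv_mul ιP d le_rfl μ]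
      exact Ideal.mul_mem_right _ _ (Ideal.subset_span ⟨k, rfl⟩)
    · intro c n hn
      rw [Scheme.Modules.Hom.app_smul, appLE_smul_right]
      exact Ideal.mul_mem_left _ _ hn
    · intro n₁ n₂ h₁ h₂
      rw [map_add, appLE_add_right]
      exact Ideal.add_mem _ h₁ h₂
  · -- `≥`: the coordinate of `v♭(η(k)|)` is the value of the chart functional
    rw [Ideal.span_le]
    rintro _ ⟨k, rfl⟩
    let μ₀ : (twistMod ιP (unitModule P) d).over (Zop ιP {j}) ⟶ (unitModule P).over (Zop ιP {j}) :=
      overHomMk' (fun W' k' => (chartEquiv ιP (unitModule P) d (k'.le : W' ≤ Zop ιP {j})).toAddMonoidHom)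
        (fun W' k' c s => by
          change chartEquiv ιP (unitModule P) d _ (c • s) = c • chartEquiv ιP (unitModule P) d _ s
          rw [map_smul])
        (fun W' V k' k'' l s => by
          change chartEquiv ιP (unitModule P) d _ ((twistMod ιP (unitModule P) d).presheaf.map l.op s) =
            (unitModule P).presheaf.map l.op (chartEquiv ιP (unitModule P) d _ s)
          rw [show l = homOfLE l.le from Subsingleton.elim _ _]
          exact chartEquiv_map ιP (unitModule P) d k'.le l.le s)
    have hval : (show Γ(P, Zop ιP {j}) from chartEquiv ιP (unitModule P) d (le_refl (Zop ιP {j}))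
        ((twistMod ιP (unitModule P) d).presheaf.map (homOfLE (le_top : Zop ιP {j} ≤ π ⁻¹ᵁ ⊤)).op
          (show Γ(twistMod ιP (unitModule P) d, π ⁻¹ᵁ ⊤) from v.app ⊤ k))) =
        (show Γ(P, Zop ιP {j}) from appLE μ₀ (𝟙 _)
          ((((Scheme.Modules.pullbackPushforwardAdjunction π).homEquiv K _).symm v).app (Zop ιP {j})
            (unitSectionLE π K i k))) := by
      rw [happ k, appLE_overHomMk']
      rfl
    change (show Γ(P, Zop ιP {j}) from chartEquiv ιP (unitModule P) d (le_refl (Zop ιP {j}))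
      ((twistMod ιP (unitModule P) d).presheaf.map (homOfLE (le_top : Zop ιP {j} ≤ π ⁻¹ᵁ ⊤)).op _)) ∈ _
    rw [hval]
    exact appLE_app_mem _ (Zop ιP {j}) _ μ₀

end Literature.AlgebraicGeometry.Modules

end
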